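import Literature.MathematicalPhysics.KineticTheory.HardSphereBBGKYLiouvilleFlow
import Literature.Analysis.FluidPDE.HardSphereUniqueness
import HarnessLib

/-!
# The tagged subsystem of a hard-sphere flow between tagged–untagged collisions

Second file of the proof of `Literature.MathematicalPhysics.KineticTheory.bbgky_hierarchy_of_liouville`
(**hilbert6.S07**; plan in `HardSphereBBGKYLiouvilleFlow`). The BBGKY hierarchy compares the
`(s+m)`-particle hard-sphere flow `Φ^{s+m}` with the `s`-particle flow `Φ^s` of the first `s`
("tagged") particles. The two hypothesis structures `HardSphereFlow G ε (s+m)` and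
`HardSphereFlow G ε s` are a priori unrelated; what relates them is forward uniqueness of
hard-sphere trajectories (`IsHardSphereTrajectory.unique_holds`, GST 2013 §4.1): as long as no
tagged particle touches an untagged one, the tagged sub-configuration of the `(s+m)`-orbit is
itself a (piece of a) hard-sphere trajectory of `s` particles, hence coincides with the `Φ^s`-orbit
of its initial value. Since the tagged sub-configuration is a trajectory only on a time
*interval*, we need a local version of uniqueness:

* `eqOn_Icc_of_hardSphereEvents` (§1): **local forward uniqueness.** Two curves in phase space
  which on `[a, b]` are free flight between the times of finite *event sets* `E ⊇` their contact
  times, jump by the elastic law from their left limit at contact events and are left-continuous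
  at non-contact events, and agree at time `a`, agree on `[a, b]`. The proof is that of
  `IsHardSphereTrajectory.unique_holds` (infimum of the disagreement times) run relative to the
  event sets.
* restriction to the tagged particles `z ∘ Fin.castAdd m` (§2): it commutes with free flight,
  with the collision of a tagged pair, is unchanged by the collision of an untagged pair, and
  transports membership in the hard-sphere domain and in contact sets.
* `HardSphereFlow.tagged_flow_eq` (§3): **the subsystem lemma.** If `z` is good for `Φ^{s+m}`,
  its tagged part is good for `Φ^s`, and on `(0, h]` every contact of the `(s+m)`-orbit of `z` is
  tagged–tagged or untagged–untagged, then for `τ ∈ [0, h]` the tagged part of `Φ^{s+m}_τ z` is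
  `Φ^s_τ (z ∘ Fin.castAdd m)` (Hausdorff position space, continuous translations — e.g. `T^d`).

Theorems only; no definition and no named fact is introduced.

## References

* I. Gallagher, L. Saint-Raymond, B. Texier, *From Newton to Boltzmann*, EMS (2013),
  arXiv:1208.5753, §4.1 (well-posedness of the hard-sphere flow away from a null set), §4.3
  (the `s`-particle flow in the BBGKY hierarchy).
* C. Cercignani, R. Illner, M. Pulvirenti, *The Mathematical Theory of Dilute Gases*, Springer
  (1994), §4.3 (the flow `T^{(s)}_t` of the tagged group), App. 4.A.
* H. Spohn, *On the integrated form of the BBGKY hierarchy for hard spheres*,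
  arXiv:math-ph/0605068, §2 (dynamics of a subgroup of particles between its collisions with the
  others).
-/

open MeasureTheory Set Filter Topology

namespace Literature.MathematicalPhysics.KineticTheory

open Literature.Analysis.FluidPDE

noncomputable section

variable {d : Type*} [Fintype d] {X : Type*}

/-! ## §1. Local forward uniqueness relative to event sets -/

section LocalUnique

variable [TopologicalSpace X] {G : Geometry d X} {ε : ℝ} {n : ℕ}

/-- Free flight from a common value along a collision-free open interval determines the left
limit: if `γ u = S_{u-s}(γ s)` for `u ∈ (s, τ)` then `γ → S_{τ-s}(γ s)` as `u ↑ τ` (translations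
continuous). [folklore] -/
theorem tendsto_nhdsLT_of_freeFlight_Ioo (hG : ∀ x : X, Continuous (G.translate x))
    {γ : ℝ → Config n d X} {s τ : ℝ} (hsτ : s < τ)
    (h : ∀ u ∈ Ioo s τ, γ u = freeFlight G (u - s) (γ s)) :
    Tendsto γ (𝓝[<] τ) (𝓝 (freeFlight G (τ - s) (γ s))) := by
  have hc : Continuous fun u : ℝ => freeFlight G (u - s) (γ s) := by
    have hff := continuous_freeFlight_of_continuous_translate hG (γ s)
    fun_prop
  refine ((hc.tendsto τ).mono_left nhdsWithin_le_nhds).congr' ?_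
  filter_upwards [Ioo_mem_nhdsLT hsτ] with u hu
  exact (h u hu).symm

/-- **Local forward uniqueness of piecewise free flights with elastic jumps.** Let `γ, γ'` be
curves in the `n`-particle phase space with continuous positions, and `E, E'` sets of "event
times", finite in `[a, b]`, such that on `[a, b]`: each curve is free flight across every
interval `(s, t]` without events; every contact time in `(a, b]` is an event; at an event which
is a contact time of the pair `(i, j)` the curve has a left limit of which its value is the
elastic reflection `collidePair G i j`; and at an event which is not a contact time the curve is
left-continuous. If `γ a = γ' a` then `γ = γ'` on `[a, b]`. This is the argument of
`IsHardSphereTrajectory.unique_holds` (GST 2013 §4.1; CIP 1994 App. 4.A: infimum `τ` of the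
disagreement times; positions agree at `τ` by continuity; a contact at `τ` is a contact of both,
with equal left limits, hence equal outcomes; otherwise both are the free flight of the common
value at the last event before `τ`, up to and — by left-continuity — including `τ`; then free
flight on a right neighbourhood of `τ` gives the contradiction), run relative to event sets so
that it applies to sub-configurations of a trajectory, whose velocity is continuous at the
collisions of the other particles. Hausdorff position space, continuous translations. [cite: GST2013, §4.1] -/
theorem eqOn_Icc_of_hardSphereEvents [T2Space X] (hG : ∀ x : X, Continuous (G.translate x))
    {γ γ' : ℝ → Config n d X} {a b : ℝ} {E E' : Set ℝ}
    (hE : (E ∩ Icc a b).Finite) (hE' : (E' ∩ Icc a b).Finite)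
    (hpos : ∀ i, Continuous fun t => (γ t i).1) (hpos' : ∀ i, Continuous fun t => (γ' t i).1)
    (hfree : ∀ s t, a ≤ s → s ≤ t → t ≤ b → (∀ u ∈ Ioc s t, u ∉ E) →
      γ t = freeFlight G (t - s) (γ s))
    (hfree' : ∀ s t, a ≤ s → s ≤ t → t ≤ b → (∀ u ∈ Ioc s t, u ∉ E') →
      γ' t = freeFlight G (t - s) (γ' s))
    (hjump : ∀ t ∈ Ioc a b, t ∈ E → ∀ i j : Fin n, i ≠ j → γ t ∈ contactSet G n ε i j →
      ∃ zl, Tendsto γ (𝓝[<] t) (𝓝 zl) ∧ γ t = collidePair G i j zl)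
    (hjump' : ∀ t ∈ Ioc a b, t ∈ E' → ∀ i j : Fin n, i ≠ j → γ' t ∈ contactSet G n ε i j →
      ∃ zl, Tendsto γ' (𝓝[<] t) (𝓝 zl) ∧ γ' t = collidePair G i j zl)
    (hcont : ∀ t ∈ Ioc a b, t ∈ E → (∀ i j : Fin n, i ≠ j → γ t ∉ contactSet G n ε i j) →
      Tendsto γ (𝓝[<] t) (𝓝 (γ t)))
    (hcont' : ∀ t ∈ Ioc a b, t ∈ E' → (∀ i j : Fin n, i ≠ j → γ' t ∉ contactSet G n ε i j) →
      Tendsto γ' (𝓝[<] t) (𝓝 (γ' t)))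
    (hsub : ∀ t ∈ Ioc a b, ∀ i j : Fin n, i ≠ j → γ t ∈ contactSet G n ε i j → t ∈ E)
    (hsub' : ∀ t ∈ Ioc a b, ∀ i j : Fin n, i ≠ j → γ' t ∈ contactSet G n ε i j → t ∈ E')
    (h0 : γ a = γ' a) : EqOn γ γ' (Icc a b) := by
  classical
  intro t₁ ht₁
  by_contra hne₁
  set S : Set ℝ := {t | t ∈ Icc a b ∧ γ t ≠ γ' t} with hS
  have hSne : S.Nonempty := ⟨t₁, ht₁, hne₁⟩
  have hSbdd : BddBelow S := ⟨a, fun t ht => ht.1.1⟩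
  set τ := sInf S with hτ
  have haτ : a ≤ τ := le_csInf hSne fun t ht => ht.1.1
  have hτb : τ ≤ b := (csInf_le hSbdd ⟨ht₁, hne₁⟩).trans ht₁.2
  have hagree : ∀ t, a ≤ t → t < τ → γ t = γ' t := fun t h1 h2 => by
    by_contra hne'
    exact (lt_irrefl t) (h2.trans_le (csInf_le hSbdd ⟨⟨h1, h2.le.trans hτb⟩, hne'⟩))
  -- all events in `[a, b]`: a finite set
  have hwindow : ((E ∪ E') ∩ Icc a b).Finite :=
    (hE.union hE').subset (by
      rintro u ⟨hu | hu, hI⟩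
      exacts [Or.inl ⟨hu, hI⟩, Or.inr ⟨hu, hI⟩])
  -- Step A: agreement at `τ`
  have hA : γ τ = γ' τ := by
    rcases haτ.eq_or_lt with heq | hlt
    · rw [← heq]; exact h0
    have hτI : τ ∈ Ioc a b := ⟨hlt, hτb⟩
    have hev : γ =ᶠ[𝓝[<] τ] γ' := by
      filter_upwards [Ioo_mem_nhdsLT hlt] with t ht
      exact hagree t ht.1.le ht.2
    -- positions agree at `τ`
    have hposτ : ∀ k, (γ τ k).1 = (γ' τ k).1 := by
      intro k
      have hc : Tendsto (fun t => (γ t k).1) (𝓝[<] τ) (𝓝 (γ τ k).1) :=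
        ((hpos k).tendsto τ).mono_left nhdsWithin_le_nhds
      have hc' : Tendsto (fun t => (γ' t k).1) (𝓝[<] τ) (𝓝 (γ' τ k).1) :=
        ((hpos' k).tendsto τ).mono_left nhdsWithin_le_nhds
      have heq : (fun t => (γ t k).1) =ᶠ[𝓝[<] τ] fun t => (γ' t k).1 := by
        filter_upwards [hev] with t ht
        rw [ht]
      exact tendsto_nhds_unique (hc.congr' heq) hc'
    by_cases hcol : ∃ i j : Fin n, i ≠ j ∧ γ τ ∈ contactSet G n ε i j
    · -- a contact of both curves at `τ`: same pair, same left limit, same outcome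
      obtain ⟨i, j, hij, hct⟩ := hcol
      have hct' : γ' τ ∈ contactSet G n ε i j := (mem_contactSet_iff_of_pos_eq hposτ).1 hct
      obtain ⟨zl, hzl, hγ⟩ := hjump τ hτI (hsub τ hτI i j hij hct) i j hij hct
      obtain ⟨zl', hzl', hγ'⟩ := hjump' τ hτI (hsub' τ hτI i j hij hct') i j hij hct'
      have hzz : zl = zl' := tendsto_nhds_unique (hzl.congr' hev) hzl'
      rw [hγ, hγ', hzz]
    · -- no contact at `τ`: free flight from the last event before `τ`
      push Not at hcol
      have hcol' : ∀ i j : Fin n, i ≠ j → γ' τ ∉ contactSet G n ε i j := fun i j hij h =>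
        hcol i j hij ((mem_contactSet_iff_of_pos_eq hposτ).2 h)
      set C : Finset ℝ := insert a (hwindow.toFinset.filter fun u => u < τ) with hC
      have hCne : C.Nonempty := ⟨a, Finset.mem_insert_self _ _⟩
      set s := C.max' hCne with hsdef
      have has : a ≤ s := C.le_max' a (Finset.mem_insert_self _ _)
      have hsτ : s < τ := by
        have hsmem : s ∈ C := C.max'_mem hCne
        rcases Finset.mem_insert.1 hsmem with hs | hs
        · rw [hs]; exact hlt
        · exact (Finset.mem_filter.1 hs).2
      -- no event of either curve in `(s, τ)`
      have hnoev : ∀ u ∈ Ioo s τ, u ∉ E ∧ u ∉ E' := by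
        intro u hu
        have key : u ∉ E ∪ E' := by
          intro huc
          have huC : u ∈ (E ∪ E') ∩ Icc a b := ⟨huc, has.trans hu.1.le, hu.2.le.trans hτb⟩
          have : u ≤ s := C.le_max' u
            (Finset.mem_insert_of_mem (Finset.mem_filter.2 ⟨hwindow.mem_toFinset.2 huC, hu.2⟩))
          exact (not_le.2 hu.1) this
        exact ⟨fun hu' => key (Or.inl hu'), fun hu' => key (Or.inr hu')⟩
      -- both curves are free flights from `s` on `(s, τ)`, hence (left-continuity) at `τ`
      have hγu : ∀ u ∈ Ioo s τ, γ u = freeFlight G (u - s) (γ s) := fun u hu =>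
        hfree s u has hu.1.le (hu.2.le.trans hτb) fun w hw => (hnoev w ⟨hw.1, hw.2.trans_lt hu.2⟩).1
      have hγ'u : ∀ u ∈ Ioo s τ, γ' u = freeFlight G (u - s) (γ' s) := fun u hu =>
        hfree' s u has hu.1.le (hu.2.le.trans hτb) fun w hw => (hnoev w ⟨hw.1, hw.2.trans_lt hu.2⟩).2
      have hγτ : γ τ = freeFlight G (τ - s) (γ s) := by
        by_cases hτE : τ ∈ E
        · exact tendsto_nhds_unique (hcont τ hτI hτE hcol)
            (tendsto_nhdsLT_of_freeFlight_Ioo hG hsτ hγu)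
        · refine hfree s τ has hsτ.le hτb fun w hw => ?_
          rcases hw.2.eq_or_lt with rfl | hlt'
          · exact hτE
          · exact (hnoev w ⟨hw.1, hlt'⟩).1
      have hγ'τ : γ' τ = freeFlight G (τ - s) (γ' s) := by
        by_cases hτE : τ ∈ E'
        · exact tendsto_nhds_unique (hcont' τ hτI hτE hcol')
            (tendsto_nhdsLT_of_freeFlight_Ioo hG hsτ hγ'u)
        · refine hfree' s τ has hsτ.le hτb fun w hw => ?_
          rcases hw.2.eq_or_lt with rfl | hlt'
          · exact hτE
          · exact (hnoev w ⟨hw.1, hlt'⟩).2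
      rw [hγτ, hγ'τ, hagree s has hsτ]
  -- Step B: agreement on a right neighbourhood of `τ` (within `[a, b]`)
  obtain ⟨η, hη, hB⟩ : ∃ η > 0, ∀ t, τ < t → t < τ + η → t ≤ b → γ t = γ' t := by
    set C' : Finset ℝ := (insert (b + 1) hwindow.toFinset).filter fun u => τ < u with hC'
    have hC'ne : C'.Nonempty :=
      ⟨b + 1, Finset.mem_filter.2 ⟨Finset.mem_insert_self _ _, by linarith⟩⟩
    set m := C'.min' hC'ne with hmdef
    have hmτ : τ < m := (Finset.mem_filter.1 (C'.min'_mem hC'ne)).2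
    refine ⟨m - τ, sub_pos.2 hmτ, fun t h1 h2 h3 => ?_⟩
    have h2' : t < m := by linarith
    have hnoev : ∀ u ∈ Ioc τ t, u ∉ E ∧ u ∉ E' := by
      intro u hu
      have key : u ∉ E ∪ E' := by
        intro huc
        have huC : u ∈ (E ∪ E') ∩ Icc a b := ⟨huc, haτ.trans hu.1.le, hu.2.trans h3⟩
        have hu'' : u ∈ C' := Finset.mem_filter.2
          ⟨Finset.mem_insert_of_mem (hwindow.mem_toFinset.2 huC), hu.1⟩
        have : m ≤ u := C'.min'_le u hu''
        linarith [hu.2]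
      exact ⟨fun hu' => key (Or.inl hu'), fun hu' => key (Or.inr hu')⟩
    rw [hfree τ t haτ h1.le h3 fun u hu => (hnoev u hu).1,
      hfree' τ t haτ h1.le h3 fun u hu => (hnoev u hu).2, hA]
  -- Step C: `τ + η` is a lower bound of the disagreement set, contradiction
  have hle : τ + η ≤ τ := by
    refine le_csInf hSne fun t ht => ?_
    by_contra hlt
    push Not at hlt
    have hτt : τ ≤ t := csInf_le hSbdd ht
    rcases hτt.eq_or_lt with heq | hlt'
    · exact ht.2 (heq ▸ hA)
    · exact ht.2 (hB t hlt' hlt ht.1.2)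
  linarith

/-- A (global) hard-sphere trajectory jumps by the elastic law from its left limit at a contact
time of the pair `(i, j)` (the `binary` field). [folklore] -/
theorem IsHardSphereTrajectory.jump_of_contact {γ : ℝ → Config n d X}
    (h : IsHardSphereTrajectory G ε n γ) (t : ℝ) {i j : Fin n} (hij : i ≠ j)
    (hc : γ t ∈ contactSet G n ε i j) :
    ∃ zl, Tendsto γ (𝓝[<] t) (𝓝 zl) ∧ γ t = collidePair G i j zl := by
  obtain ⟨-, zl, hzl, -, heq⟩ := h.binary t i j hij hc
  exact ⟨zl, hzl, heq⟩

omit [TopologicalSpace X] in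
/-- A contact time of a curve is one of its collision times. [folklore] -/
theorem mem_collisionTimes_of_mem_contactSet {γ : ℝ → Config n d X} {t : ℝ} {i j : Fin n}
    (hij : i ≠ j) (hc : γ t ∈ contactSet G n ε i j) : t ∈ collisionTimes G ε γ :=
  ⟨i, j, hij, hc⟩

end LocalUnique

/-! ## §2. Restriction to the tagged particles -/

section Tagged

variable {G : Geometry d X} {ε : ℝ} {s m : ℕ}

/-- Restriction to the tagged particles commutes with free flight. [folklore] -/
theorem freeFlight_comp_castAdd (t : ℝ) (z : Config (s + m) d X) :
    (freeFlight G t z ∘ Fin.castAdd m : Config s d X) = freeFlight G t (z ∘ Fin.castAdd m) := rfl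

/-- A configuration of the hard-sphere domain restricts to one. [folklore] -/
theorem comp_castAdd_mem_hardSphereDomain {z : Config (s + m) d X}
    (hz : z ∈ hardSphereDomain G (s + m) ε) :
    (z ∘ Fin.castAdd m : Config s d X) ∈ hardSphereDomain G s ε := by
  rw [mem_hardSphereDomain] at hz ⊢
  intro i j hij
  exact hz (Fin.castAdd m i) (Fin.castAdd m j) fun h => hij (Fin.castAdd_injective _ _ h)

/-- For a configuration of the hard-sphere domain, the tagged part is a contact configuration of
the tagged pair `(i, j)` iff the configuration is one of `(castAdd i, castAdd j)`. [folklore] -/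
theorem comp_castAdd_mem_contactSet_iff {z : Config (s + m) d X}
    (hz : z ∈ hardSphereDomain G (s + m) ε) (i j : Fin s) :
    (z ∘ Fin.castAdd m : Config s d X) ∈ contactSet G s ε i j ↔
      z ∈ contactSet G (s + m) ε (Fin.castAdd m i) (Fin.castAdd m j) := by
  simp only [mem_contactSet, hz, comp_castAdd_mem_hardSphereDomain hz, true_and,
    Function.comp_apply]

/-- Restriction to the tagged particles commutes with the collision of a tagged pair. [folklore] -/
theorem collidePair_comp_castAdd {i j : Fin s} (hij : i ≠ j) (z : Config (s + m) d X) :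
    (collidePair G (Fin.castAdd m i) (Fin.castAdd m j) z ∘ Fin.castAdd m : Config s d X) =
      collidePair G i j (z ∘ Fin.castAdd m) := by
  have hIJ : Fin.castAdd m i ≠ Fin.castAdd m j := fun h => hij (Fin.castAdd_injective _ _ h)
  funext k
  by_cases hkj : k = j
  · subst hkj
    simp only [Function.comp_apply, collidePair_apply_right]
  by_cases hki : k = i
  · subst hki
    simp only [Function.comp_apply, collidePair_apply_left hIJ, collidePair_apply_left hij]
  · have hkI : Fin.castAdd m k ≠ Fin.castAdd m i := fun h => hki (Fin.castAdd_injective _ _ h)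
    have hkJ : Fin.castAdd m k ≠ Fin.castAdd m j := fun h => hkj (Fin.castAdd_injective _ _ h)
    simp only [Function.comp_apply, collidePair_apply_of_ne hkI hkJ, collidePair_apply_of_ne hki hkj]

/-- The collision of an untagged pair does not affect the tagged particles. [folklore] -/
theorem collidePair_natAdd_comp_castAdd (i j : Fin m) (z : Config (s + m) d X) :
    (collidePair G (Fin.natAdd s i) (Fin.natAdd s j) z ∘ Fin.castAdd m : Config s d X) =
      z ∘ Fin.castAdd m := by
  funext k
  have hkI : Fin.castAdd m k ≠ Fin.natAdd s i := fun h => by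
    have := congrArg Fin.val h
    simp at this
    omega
  have hkJ : Fin.castAdd m k ≠ Fin.natAdd s j := fun h => by
    have := congrArg Fin.val h
    simp at this
    omega
  simp only [Function.comp_apply, collidePair_apply_of_ne hkI hkJ]

omit [Fintype d] in
/-- Restriction to the tagged particles is continuous. [folklore] -/
theorem continuous_comp_castAdd [TopologicalSpace X] :
    Continuous fun z : Config (s + m) d X => (z ∘ Fin.castAdd m : Config s d X) :=
  continuous_pi fun _ => continuous_apply _

/-- An index of `Fin (s + m)` is tagged (`castAdd`) or untagged (`natAdd`). [folklore] -/
theorem eq_castAdd_or_eq_natAdd (I : Fin (s + m)) :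
    (∃ i : Fin s, I = Fin.castAdd m i) ∨ ∃ j : Fin m, I = Fin.natAdd s j := by
  refine Fin.addCases (fun i => Or.inl ⟨i, rfl⟩) (fun j => Or.inr ⟨j, rfl⟩) I

end Tagged

/-! ## §3. The subsystem lemma -/

section Subsystem

variable [MeasureSpace X] [TopologicalSpace X] {G : Geometry d X} {ε : ℝ} {s m : ℕ}

/-- **The tagged subsystem follows its own flow between tagged–untagged collisions.** Let `Φs`,
`ΦN` be hard-sphere flows of `s` and `s + m` particles (same geometry and diameter), `z` a good
datum of `ΦN` whose tagged part `z ∘ Fin.castAdd m` is good for `Φs`, and `h ≥ 0` such that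
every contact of the orbit `ΦN_τ z`, `τ ∈ (0, h]`, is between two tagged or two untagged
particles. Then for `τ ∈ [0, h]` the tagged part of `ΦN_τ z` is `Φs_τ (z ∘ Fin.castAdd m)`.
Proof: the tagged part of the `ΦN`-orbit is free flight between the collision times of the
orbit, jumps by the elastic law at tagged–tagged collisions and is continuous at
untagged–untagged ones; so `eqOn_Icc_of_hardSphereEvents` applies to it and to the `Φs`-orbit.
This is the (only) relation between the flows `Φ s` and `Φ N` used in the derivation of the
BBGKY hierarchy (CIP 1994 §4.3: `P^{(s)}(T^{(s)}_t z^s, t)`; Spohn 2006 §2; GST 2013 §4.3),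
valid for a Hausdorff position space with continuous translations. [cite: CIP1994, §4.3] -/
theorem _root_.Literature.Analysis.FluidPDE.HardSphereFlow.tagged_flow_eq [T2Space X]
    (hG : ∀ x : X, Continuous (G.translate x)) (Φs : HardSphereFlow G ε s)
    (ΦN : HardSphereFlow G ε (s + m)) {z : Config (s + m) d X} (hz : z ∈ ΦN.good)
    (hzs : (z ∘ Fin.castAdd m : Config s d X) ∈ Φs.good) {h : ℝ}
    (hnc : ∀ τ ∈ Ioc 0 h, ∀ I J : Fin (s + m), I ≠ J →
      ΦN.flow τ z ∈ contactSet G (s + m) ε I J → ((I : ℕ) < s ↔ (J : ℕ) < s)) :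
    ∀ τ ∈ Icc 0 h, (ΦN.flow τ z ∘ Fin.castAdd m : Config s d X) =
      Φs.flow τ (z ∘ Fin.castAdd m) := by
  have hγN := ΦN.isTrajectory z hz
  have hγs := Φs.isTrajectory _ hzs
  -- the two curves and their event sets
  set γ : ℝ → Config s d X := fun τ => (ΦN.flow τ z ∘ Fin.castAdd m : Config s d X) with hγdef
  set γ' : ℝ → Config s d X := fun τ => Φs.flow τ (z ∘ Fin.castAdd m) with hγ'def
  set E : Set ℝ := collisionTimes G ε fun τ => ΦN.flow τ z with hEdef
  set E' : Set ℝ := collisionTimes G ε γ' with hE'def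
  -- a tagged contact of `γ` is a contact of the big orbit
  have htc : ∀ τ (i j : Fin s), γ τ ∈ contactSet G s ε i j →
      ΦN.flow τ z ∈ contactSet G (s + m) ε (Fin.castAdd m i) (Fin.castAdd m j) :=
    fun τ i j hc => (comp_castAdd_mem_contactSet_iff (hγN.mem τ) i j).1 hc
  have key : EqOn γ γ' (Icc 0 h) := by
    refine eqOn_Icc_of_hardSphereEvents (G := G) (ε := ε) hG (E := E) (E' := E')
      (hγN.locFinite 0 h) (hγs.locFinite 0 h) ?_ ?_ ?_ ?_ ?_ ?_ ?_ ?_ ?_ ?_ ?_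
    · intro i
      exact hγN.pos_continuous (Fin.castAdd m i)
    · intro i
      exact hγs.pos_continuous i
    · -- free flight of the tagged part across collision-free intervals of the big orbit
      intro σ τ _ hστ _ hfree
      show (ΦN.flow τ z ∘ Fin.castAdd m : Config s d X) = _
      rw [hγN.free σ τ hστ hfree]
      rfl
    · intro σ τ _ hστ _ hfree
      exact hγs.free σ τ hστ hfree
    · -- tagged–tagged contact: jump of the tagged part
      intro τ _ _ i j hij hc
      have hIJ : Fin.castAdd m i ≠ Fin.castAdd m j := fun h => hij (Fin.castAdd_injective _ _ h)
      obtain ⟨-, zl, hzl, -, heq⟩ := hγN.binary τ _ _ hIJ (htc τ i j hc)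
      refine ⟨zl ∘ Fin.castAdd m, ?_, ?_⟩
      · exact ((continuous_comp_castAdd (s := s) (m := m)).tendsto zl).comp hzl
      · show (ΦN.flow τ z ∘ Fin.castAdd m : Config s d X) = _
        rw [heq, collidePair_comp_castAdd hij]
    · intro τ _ _ i j hij hc
      obtain ⟨-, zl, hzl, -, heq⟩ := hγs.binary τ i j hij hc
      exact ⟨zl, hzl, heq⟩
    · -- an event of the big orbit which is not a tagged contact is an untagged–untagged
      -- collision: the tagged part is (left-)continuous there
      intro τ hτ hτE hnot
      obtain ⟨I, J, hIJ, hc⟩ := hτE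
      have hIJ' := hnc τ hτ I J hIJ hc
      rcases eq_castAdd_or_eq_natAdd I with ⟨i, rfl⟩ | ⟨i, rfl⟩
      · -- `I` tagged, hence `J` tagged: a tagged contact, excluded
        rcases eq_castAdd_or_eq_natAdd J with ⟨j, rfl⟩ | ⟨j, rfl⟩
        · have hij : i ≠ j := fun h => hIJ (h ▸ rfl)
          exact absurd ((comp_castAdd_mem_contactSet_iff (hγN.mem τ) i j).2 hc) (hnot i j hij)
        · exfalso
          have h1 : ((Fin.castAdd m i : Fin (s + m)) : ℕ) < s := by simp
          have h2 : ¬ ((Fin.natAdd s j : Fin (s + m)) : ℕ) < s := by simp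
          exact h2 (hIJ'.1 h1)
      · rcases eq_castAdd_or_eq_natAdd J with ⟨j, rfl⟩ | ⟨j, rfl⟩
        · exfalso
          have h1 : ((Fin.castAdd m j : Fin (s + m)) : ℕ) < s := by simp
          have h2 : ¬ ((Fin.natAdd s i : Fin (s + m)) : ℕ) < s := by simp
          exact h2 (hIJ'.2 h1)
        · -- untagged–untagged collision
          obtain ⟨-, zl, hzl, -, heq⟩ := hγN.binary τ _ _ hIJ hc
          have hlim : Tendsto γ (𝓝[<] τ) (𝓝 (zl ∘ Fin.castAdd m)) :=
            ((continuous_comp_castAdd (s := s) (m := m)).tendsto zl).comp hzl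
          have hval : γ τ = (zl ∘ Fin.castAdd m : Config s d X) := by
            show (ΦN.flow τ z ∘ Fin.castAdd m : Config s d X) = _
            rw [heq, collidePair_natAdd_comp_castAdd]
          rw [hval]
          exact hlim
    · -- an event of the small orbit is a contact time: nothing to prove
      intro τ _ hτE hnot
      obtain ⟨i, j, hij, hc⟩ := hτE
      exact absurd hc (hnot i j hij)
    · intro τ _ i j hij hc
      have hIJ : Fin.castAdd m i ≠ Fin.castAdd m j := fun h => hij (Fin.castAdd_injective _ _ h)
      exact ⟨_, _, hIJ, htc τ i j hc⟩
    · intro τ _ i j hij hc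
      exact ⟨i, j, hij, hc⟩
    · show (ΦN.flow 0 z ∘ Fin.castAdd m : Config s d X) = Φs.flow 0 (z ∘ Fin.castAdd m)
      rw [ΦN.flow_zero z hz, Φs.flow_zero _ hzs]
  intro τ hτ
  exact key hτ

/-- The subsystem lemma from an arbitrary initial time: if `z` is good for `ΦN`, the tagged part
of `ΦN_{t₀} z` is good for `Φs`, and on `(t₀, t₀ + h]` every contact of the orbit is
tagged–tagged or untagged–untagged, then for `τ ∈ [0, h]` the tagged part of `ΦN_{t₀+τ} z` is
`Φs_τ` of the tagged part of `ΦN_{t₀} z` (group property and `tagged_flow_eq`). [folklore] -/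
theorem _root_.Literature.Analysis.FluidPDE.HardSphereFlow.tagged_flow_eq_of_flow [T2Space X]
    (hG : ∀ x : X, Continuous (G.translate x)) (Φs : HardSphereFlow G ε s)
    (ΦN : HardSphereFlow G ε (s + m)) {z : Config (s + m) d X} (hz : z ∈ ΦN.good) (t₀ : ℝ)
    (hzs : (ΦN.flow t₀ z ∘ Fin.castAdd m : Config s d X) ∈ Φs.good) {h : ℝ}
    (hnc : ∀ τ ∈ Ioc t₀ (t₀ + h), ∀ I J : Fin (s + m), I ≠ J →
      ΦN.flow τ z ∈ contactSet G (s + m) ε I J → ((I : ℕ) < s ↔ (J : ℕ) < s)) :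
    ∀ τ ∈ Icc 0 h, (ΦN.flow (t₀ + τ) z ∘ Fin.castAdd m : Config s d X) =
      Φs.flow τ (ΦN.flow t₀ z ∘ Fin.castAdd m) := by
  intro τ hτ
  have hz₀ : ΦN.flow t₀ z ∈ ΦN.good := ΦN.mapsTo_good t₀ hz
  have h1 : ΦN.flow (t₀ + τ) z = ΦN.flow τ (ΦN.flow t₀ z) := by
    rw [show t₀ + τ = τ + t₀ from add_comm _ _, ΦN.flow_add τ t₀ z hz]
  rw [h1]
  refine HardSphereFlow.tagged_flow_eq hG Φs ΦN hz₀ hzs (fun σ hσ I J hIJ hc => ?_) τ hτ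
  refine hnc (t₀ + σ) ⟨by linarith [hσ.1], by linarith [hσ.2]⟩ I J hIJ ?_
  rwa [show t₀ + σ = σ + t₀ from add_comm _ _, ΦN.flow_add σ t₀ z hz]

end Subsystem

end

end Literature.MathematicalPhysics.KineticTheory
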